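import Literature.NumberTheory.Weil1964.AdelicThetaDistribution
import Literature.NumberTheory.Weil1964.ThetaLift
import Literature.NumberTheory.Automorphic.StandardTestFunGaussian
import HarnessLib

/-!
# The adelic Gaussian: its theta distribution is a classical theta series, hence non-zero

Topic `NumberTheory/Weil1964`; namespace `Literature.NumberTheory.Weil1964`.  KERNEL file (no new named fact, no
hypothesis record, no `sorry`): two definitions with bodies and proved theorems.

Weil's theta distribution of the vector space `X = Fⁿ` over a number field `F` is `Θ(Φ) = Σ_{ξ ∈ Fⁿ} Φ(ξ)` on the
Schwartz–Bruhat space `𝒮(𝔸_Fⁿ) = piSchwartzBruhat F (Fin n)` ([Weil1964, Chap. III n° 41 Thm 6 p. 193]; tree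
`AdelicThetaDistribution`: `thetaDist`, absolute convergence `hasSum_thetaDist`).  This file evaluates it on THE ADELIC
GAUSSIAN and records the two generic consequences "non-zero kernel value ⇒ non-zero theta kernel / theta lift" used by
the non-vacuity instances of the dual-pair theta kernels (`GelbartRogawski1991/UnitaryDualPairThetaKernelGaussian`).

* §1 `gaussSB F n = e^{-‖T z_∞‖²} ⊗ 𝟙_{𝒪̂ⁿ} ∈ 𝒮(𝔸_Fⁿ)` — the tree's Gaussian standard test function
  `standardTestFun n F (gaussArchTestFun n F)` (`StandardTestFunGaussian`; Cogdell (2004) §2.3; `T = toEuclidean` a linear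
  isomorphism of `(F ⊗ ℝ)ⁿ` onto a Euclidean space), complexified; and `gaussNormSq F n ξ = ‖T(j(ξ))‖²` (`j` = the mixed
  embedding coordinatewise), a POSITIVE-DEFINITE quadratic form on the lattice `𝓞_Fⁿ ⊂ (F ⊗ ℝ)ⁿ`
  (`gaussNormSq_eq_zero_iff`).  On principal adeles: `Φ_G(ξ) = e^{-Q(ξ)}` for `ξ ∈ 𝓞_Fⁿ` (`gaussSB_ratPt_coe`) and
  `Φ_G(ξ) = 0` for `ξ ∈ Fⁿ ∖ 𝓞_Fⁿ` (`gaussSB_ratPt_of_not_forall_mem`; integrality criterion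
  `forall_ratPt_snd_mem_adicCompletionIntegers_iff`).
* §2 **`Θ(Φ_G) = Σ_{ξ ∈ 𝓞_Fⁿ} e^{-Q(ξ)}`** (`thetaDist_gaussSB_eq_tsum`, `hasSum_thetaDist_gaussSB_int`,
  real form `thetaDist_gaussSB_eq_ofReal`, `summable_exp_neg_gaussNormSq`): the theta distribution of the adelic Gaussian
  IS the classical theta series of the positive-definite form `Q` on the lattice `𝓞_Fⁿ`; it is a real number `≥ 1`
  (`one_le_tsum_exp_neg_gaussNormSq`, `one_le_re_thetaDist_gaussSB`: all terms `> 0`, the term `ξ = 0` is `1`), so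
  **`Θ(Φ_G) ≠ 0`** (`thetaDist_gaussSB_ne_zero`, `thetaDistLM_gaussSB_ne_zero`).
* §3 for ANY theta-kernel datum `M : ThetaKernelDatum Mp SX GU ΓU G Γ` (`ThetaKernelDualPair`, `ThetaLift`): at the
  identity the kernel upstairs is Weil's `Θ_Φ(1)` (`ThetaKernelDatum.thetaFun_one`); the slice
  `thetaKerSlice Φ ξ = θ_Φ(ξ, ·) ∈ C(G ⧸ Γ, ℂ)`; and over compact quotients with a finite Borel measure `μ`,
  `Θ_Φ(conj θ_Φ(ξ, ·))(ξ) = ∫ |θ_Φ(ξ, q)|² dμ(q)` (`thetaLift_star_slice_apply`), which is `≠ 0` as soon as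
  `θ_Φ(ξ, q₀) ≠ 0` for one `q₀` and `μ` charges open sets (`thetaLift_star_slice_ne_zero`).

NOT here: the dual-pair instances themselves (`GelbartRogawski1991/UnitaryDualPairThetaKernelGaussian`); the bump-function
witness `Θ ≠ 0` of `AdelicThetaWitness` (a different test function, kept for the splitting argument there).

## References
* A. Weil, *Sur certains groupes d'opérateurs unitaires*, Acta Math. 111 (1964) 143–211, Chap. III n° 41 Théorème 6
  p. 193 (`Θ(S) = Σ_{ξ ∈ X_k} SΦ(ξ)`), Lemme 5 p. 191 [Weil1964].
* J. W. Cogdell, *Analytic theory of L-functions for GL_n*, in *An Introduction to the Langlands Program* (2004), §2.3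
  (Gaussian standard test function) [CogdellAnalyticTheory2004].
* P. Fleig, H. P. A. Gustafsson, A. Kleinschmidt, D. Persson, *Eisenstein Series and Automorphic Representations* (2018),
  §12.3 Def. 12.5 (12.37) (the theta lift); §12.4 Example 12.7, (12.44)–(12.48) (global theta series of the Gaussian
  `e^{-πx²} ⊗ ∏_p γ_p` = classical Jacobi theta series, the sum restricting to the integers) [FleigEtAl2018].
-/

set_option autoImplicit false

noncomputable section

open scoped ComplexConjugate
open NumberField NumberField.mixedEmbedding IsDedekindDomain
open _root_.MeasureTheory
open Literature.NumberTheory.Automorphic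

namespace Literature.NumberTheory.Weil1964

/-! ## §1. The adelic Gaussian and its norm form -/

section Gaussian

variable (F : Type) [Field F] [NumberField F] (n : ℕ)

/-- **The adelic Gaussian** `Φ_G = e^{-‖T z_∞‖²} ⊗ 𝟙_{𝒪̂ⁿ}` as an element of the Schwartz–Bruhat space
`𝒮(𝔸_Fⁿ) = piSchwartzBruhat F (Fin n)`: the tree's Gaussian standard test function
`standardTestFun n F (gaussArchTestFun n F)` (Cogdell (2004) §2.3: a Gaussian at infinity, `𝟙_{𝒪_vⁿ}` at every finite
place), complexified. [cite: CogdellAnalyticTheory2004, §2.3] -/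
def gaussSB : piSchwartzBruhat F (Fin n) :=
  ⟨fun y => ((standardTestFun n F (gaussArchTestFun n F) y : ℝ) : ℂ),
    standardTestFun_gauss_mem_piSchwartzBruhat n F⟩

/-- **The norm form of the Gaussian** on the lattice `𝓞_Fⁿ ⊂ (F ⊗ ℝ)ⁿ`: `Q(ξ) = ‖T(j(ξ))‖²`, `j(ξ) = (σ(ξᵢ))_{σ,i}` the
mixed (Minkowski) embedding coordinatewise and `T = toEuclidean` the linear isomorphism of `(F ⊗ ℝ)ⁿ` onto a Euclidean
space used by `gaussArchTestFun` — a positive-definite quadratic form (`gaussNormSq_eq_zero_iff`); for `F = ℚ`,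
`n = 1` it is the exponent `π ξ²` of the classical theta series in FGKP (12.48). [cite: FleigEtAl2018, §12.4 Example 12.7, (12.45)–(12.48)] -/
def gaussNormSq (ζ : Fin n → 𝓞 F) : ℝ :=
  ‖toEuclidean (E := Fin n → mixedSpace F) (fun i => mixedEmbedding F (ζ i : F))‖ ^ 2

variable {F n}

/-- Unfolding of `gaussSB`. [cite: CogdellAnalyticTheory2004, §2.3] -/
theorem gaussSB_apply (y : Fin n → AdeleRing (𝓞 F) F) :
    (gaussSB F n : (Fin n → AdeleRing (𝓞 F) F) → ℂ) y =
      ((standardTestFun n F (gaussArchTestFun n F) y : ℝ) : ℂ) := rfl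

/-- The values of `Φ_G` are non-negative reals. [cite: CogdellAnalyticTheory2004, §2.3] -/
theorem gaussSB_re_nonneg (y : Fin n → AdeleRing (𝓞 F) F) :
    0 ≤ ((gaussSB F n : (Fin n → AdeleRing (𝓞 F) F) → ℂ) y).re := by
  rw [gaussSB_apply, Complex.ofReal_re]
  exact standardTestFun_gauss_nonneg n F y

/-- `Q(ξ) ≥ 0`. [cite: FleigEtAl2018, §12.4 Example 12.7, (12.45)–(12.48)] -/
theorem gaussNormSq_nonneg (ζ : Fin n → 𝓞 F) : 0 ≤ gaussNormSq F n ζ := sq_nonneg _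

/-- **`Q` is positive definite** on the lattice `𝓞_Fⁿ`: `Q(ξ) = 0 ↔ ξ = 0` (`T` is an isomorphism and the mixed
embedding is injective). [cite: FleigEtAl2018, §12.4 Example 12.7, (12.45)–(12.48)] -/
theorem gaussNormSq_eq_zero_iff (ζ : Fin n → 𝓞 F) : gaussNormSq F n ζ = 0 ↔ ζ = 0 := by
  unfold gaussNormSq
  rw [sq_eq_zero_iff, norm_eq_zero, map_eq_zero_iff _ (toEuclidean (E := Fin n → mixedSpace F)).injective]
  constructor
  · intro h
    funext i
    have hi := congr_fun h i
    rw [Pi.zero_apply, ← map_zero (mixedEmbedding F), (mixedEmbedding_injective F).eq_iff] at hi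
    exact Subtype.ext hi
  · rintro rfl
    funext i
    simp

/-- `Q(0) = 0`. [cite: FleigEtAl2018, §12.4 Example 12.7, (12.45)–(12.48)] -/
theorem gaussNormSq_zero : gaussNormSq F n 0 = 0 := (gaussNormSq_eq_zero_iff 0).2 rfl

/-- The finite coordinates of a principal adele: `(ξ)_{f,w} = ξ ∈ F_w`. [folklore] -/
private theorem ratPt_snd_apply (ξ : Fin n → F) (i : Fin n) (w : HeightOneSpectrum (𝓞 F)) :
    (ratPt F (Fin n) ξ i).2 w = ((ξ i : F) : w.adicCompletion F) := rfl

/-- The archimedean coordinates of a principal adele read in `F ⊗ ℝ`: the mixed embedding. [folklore] -/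
private theorem ringEquiv_mixedSpace_ratPt_fst (ξ : Fin n → F) (i : Fin n) :
    InfiniteAdeleRing.ringEquiv_mixedSpace F (ratPt F (Fin n) ξ i).1 = mixedEmbedding F (ξ i) :=
  (InfiniteAdeleRing.mixedEmbedding_eq_algebraMap_comp (x := ξ i)).symm

/-- **Integrality criterion**: the principal adele of `ξ ∈ Fⁿ` has all finite coordinates in `∏ 𝒪_w` iff `ξ ∈ 𝓞_Fⁿ`
(`|ξᵢ|_w ≤ 1` for all finite `w` iff `ξᵢ` is an algebraic integer) — FGKP Example 12.7: "the restriction to a summation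
over integers is imposed by `γ_p`", here for a general number field and rank. [cite: FleigEtAl2018, §12.4 Example 12.7, (12.45)–(12.48)] -/
theorem forall_ratPt_snd_mem_adicCompletionIntegers_iff (ξ : Fin n → F) :
    (∀ (i : Fin n) (w : HeightOneSpectrum (𝓞 F)), (ratPt F (Fin n) ξ i).2 w ∈ w.adicCompletionIntegers F) ↔
      ∀ i, ξ i ∈ (algebraMap (𝓞 F) F).range := by
  refine forall_congr' fun i => ⟨fun h => ?_, ?_⟩
  · refine HeightOneSpectrum.mem_integers_of_valuation_le_one F (ξ i) fun w => ?_
    have hw := h w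
    rw [HeightOneSpectrum.mem_adicCompletionIntegers, ratPt_snd_apply,
      HeightOneSpectrum.valuedAdicCompletion_eq_valuation'] at hw
    exact hw
  · rintro ⟨r, hr⟩ w
    rw [HeightOneSpectrum.mem_adicCompletionIntegers, ratPt_snd_apply,
      HeightOneSpectrum.valuedAdicCompletion_eq_valuation', ← hr]
    exact HeightOneSpectrum.valuation_le_one w r

/-- **`Φ_G` on the lattice**: `Φ_G(ξ) = e^{-Q(ξ)}` for `ξ ∈ 𝓞_Fⁿ` (FGKP (12.48): the terms `e^{-π n² y}`, `n ∈ ℤ`).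
[cite: FleigEtAl2018, §12.4 Example 12.7, (12.45)–(12.48)] -/
theorem gaussSB_ratPt_coe (ζ : Fin n → 𝓞 F) :
    (gaussSB F n : (Fin n → AdeleRing (𝓞 F) F) → ℂ) (ratPt F (Fin n) fun i => (ζ i : F)) =
      (Real.exp (-gaussNormSq F n ζ) : ℂ) := by
  have hint : ∀ (i : Fin n) (w : HeightOneSpectrum (𝓞 F)),
      (ratPt F (Fin n) (fun i => (ζ i : F)) i).2 w ∈ w.adicCompletionIntegers F :=
    (forall_ratPt_snd_mem_adicCompletionIntegers_iff _).2 fun i => ⟨ζ i, rfl⟩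
  rw [gaussSB_apply]
  unfold standardTestFun
  rw [if_pos hint]
  show ((Real.exp (-‖toEuclidean (E := Fin n → mixedSpace F) (fun i =>
      InfiniteAdeleRing.ringEquiv_mixedSpace F (ratPt F (Fin n) (fun i => (ζ i : F)) i).1)‖ ^ 2) : ℝ) : ℂ) = _
  simp only [ringEquiv_mixedSpace_ratPt_fst]
  rfl

/-- **`Φ_G` off the lattice**: `Φ_G(ξ) = 0` for `ξ ∈ Fⁿ ∖ 𝓞_Fⁿ` (FGKP (12.48): `∏_p γ_p(n) = 0` for `n ∈ ℚ ∖ ℤ`).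
[cite: FleigEtAl2018, §12.4 Example 12.7, (12.45)–(12.48)] -/
theorem gaussSB_ratPt_of_not_forall_mem {ξ : Fin n → F} (h : ¬ ∀ i, ξ i ∈ (algebraMap (𝓞 F) F).range) :
    (gaussSB F n : (Fin n → AdeleRing (𝓞 F) F) → ℂ) (ratPt F (Fin n) ξ) = 0 := by
  rw [gaussSB_apply]
  unfold standardTestFun
  rw [if_neg (fun h' => h ((forall_ratPt_snd_mem_adicCompletionIntegers_iff ξ).1 h')), Complex.ofReal_zero]

/-- `Φ_G(0) = 1` (the term `n = 0` of FGKP (12.48)). [cite: FleigEtAl2018, §12.4 Example 12.7, (12.45)–(12.48)] -/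
theorem gaussSB_zero : (gaussSB F n : (Fin n → AdeleRing (𝓞 F) F) → ℂ) 0 = 1 := by
  have h := gaussSB_ratPt_coe (F := F) (n := n) 0
  simp only [Pi.zero_apply, map_zero] at h
  have h0 : (ratPt F (Fin n) fun _ : Fin n => (0 : F)) = 0 := ratPt_zero
  rw [h0] at h
  rw [h, show gaussNormSq F n 0 = 0 from gaussNormSq_zero, neg_zero, Real.exp_zero, Complex.ofReal_one]

omit [NumberField F] in
/-- The lattice embedding `𝓞_Fⁿ → Fⁿ` is injective. [folklore] -/
private theorem injective_intVec_coe : Function.Injective (fun (ζ : Fin n → 𝓞 F) (i : Fin n) => (ζ i : F)) :=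
  fun _ _ h => funext fun i => RingOfIntegers.coe_injective (congr_fun h i)

/-- The terms of `Θ(Φ_G)` are supported on the lattice `𝓞_Fⁿ`. [folklore] -/
private theorem support_gaussSB_ratPt_subset :
    Function.support (fun ξ : Fin n → F => (gaussSB F n : (Fin n → AdeleRing (𝓞 F) F) → ℂ) (ratPt F (Fin n) ξ)) ⊆
      Set.range (fun (ζ : Fin n → 𝓞 F) (i : Fin n) => (ζ i : F)) := by
  intro ξ hξ
  rw [Function.mem_support] at hξ
  by_cases h : ∀ i, ξ i ∈ (algebraMap (𝓞 F) F).range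
  · choose ζ hζ using h
    exact ⟨ζ, funext hζ⟩
  · exact absurd (gaussSB_ratPt_of_not_forall_mem h) hξ

/-! ## §2. `Θ(Φ_G)` is the classical theta series of `Q`, a real number `≥ 1` -/

variable (F n)

/-- **`Θ(Φ_G)` is the sum of the absolutely convergent series `Σ_{ξ ∈ Fⁿ} Φ_G(ξ)`** (Weil's Lemme 5 in the
Schwartz–Bruhat case, tree `hasSum_thetaDist`). [cite: Weil1964, Chap. III n° 41, Thm 6 p. 193] -/
theorem hasSum_thetaDist_gaussSB :
    HasSum (fun ξ : Fin n → F => (gaussSB F n : (Fin n → AdeleRing (𝓞 F) F) → ℂ) (ratPt F (Fin n) ξ))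
      (thetaDist F (Fin n) (gaussSB F n)) :=
  hasSum_thetaDist (gaussSB F n).2

/-- **`Θ(Φ_G) = Σ_{ξ ∈ 𝓞_Fⁿ} e^{-Q(ξ)}`**: the theta distribution of the adelic Gaussian is the classical theta series
of the positive-definite norm form `Q` on the lattice `𝓞_Fⁿ` (FGKP Example 12.7 "from global theta series to classical
Jacobi theta series": for the Eulerian `φ = e^{-πx²} ⊗ ∏_p γ_p` the sum over `ℚ` restricts to `ℤ`, "the restriction to a
summation over integers is imposed by `γ_p`"). [cite: FleigEtAl2018, §12.4 Example 12.7, (12.44)–(12.48)] -/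
theorem thetaDist_gaussSB_eq_tsum :
    thetaDist F (Fin n) (gaussSB F n) = ∑' ζ : Fin n → 𝓞 F, (Real.exp (-gaussNormSq F n ζ) : ℂ) := by
  rw [thetaDist_def, ← injective_intVec_coe.tsum_eq support_gaussSB_ratPt_subset]
  exact tsum_congr fun ζ => gaussSB_ratPt_coe ζ

/-- … as a convergent series: `HasSum (ξ ↦ e^{-Q(ξ)}) Θ(Φ_G)` over `𝓞_Fⁿ`. [cite: FleigEtAl2018, §12.4 Example 12.7, (12.45)–(12.48)] -/
theorem hasSum_thetaDist_gaussSB_int :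
    HasSum (fun ζ : Fin n → 𝓞 F => (Real.exp (-gaussNormSq F n ζ) : ℂ)) (thetaDist F (Fin n) (gaussSB F n)) := by
  have h := (injective_intVec_coe.hasSum_iff (f := fun ξ : Fin n → F =>
      (gaussSB F n : (Fin n → AdeleRing (𝓞 F) F) → ℂ) (ratPt F (Fin n) ξ))
    (fun ξ hξ => Function.notMem_support.1 fun h' => hξ (support_gaussSB_ratPt_subset h'))).2
    (hasSum_thetaDist_gaussSB F n)
  have hfg : ((fun ξ : Fin n → F => (gaussSB F n : (Fin n → AdeleRing (𝓞 F) F) → ℂ) (ratPt F (Fin n) ξ)) ∘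
      fun (ζ : Fin n → 𝓞 F) (i : Fin n) => (ζ i : F)) =
      fun ζ : Fin n → 𝓞 F => (Real.exp (-gaussNormSq F n ζ) : ℂ) :=
    funext fun ζ => gaussSB_ratPt_coe ζ
  rw [hfg] at h
  exact h

/-- The real theta series `Σ_{ξ ∈ 𝓞_Fⁿ} e^{-Q(ξ)}` converges. [cite: FleigEtAl2018, §12.4 Example 12.7, (12.45)–(12.48)] -/
theorem summable_exp_neg_gaussNormSq : Summable fun ζ : Fin n → 𝓞 F => Real.exp (-gaussNormSq F n ζ) :=
  Complex.summable_ofReal.1 (hasSum_thetaDist_gaussSB_int F n).summable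

/-- **`Θ(Φ_G)` is the real number `Σ_{ξ ∈ 𝓞_Fⁿ} e^{-Q(ξ)}`.** [cite: Weil1964, Chap. III n° 41, Thm 6 p. 193] -/
theorem thetaDist_gaussSB_eq_ofReal :
    thetaDist F (Fin n) (gaussSB F n) = ((∑' ζ : Fin n → 𝓞 F, Real.exp (-gaussNormSq F n ζ) : ℝ) : ℂ) := by
  rw [thetaDist_gaussSB_eq_tsum, Complex.ofReal_tsum]

/-- **`Σ_{ξ ∈ 𝓞_Fⁿ} e^{-Q(ξ)} ≥ 1`**: all terms are positive and the term `ξ = 0` is `1`. [cite: FleigEtAl2018, §12.4 Example 12.7, (12.45)–(12.48)] -/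
theorem one_le_tsum_exp_neg_gaussNormSq : 1 ≤ ∑' ζ : Fin n → 𝓞 F, Real.exp (-gaussNormSq F n ζ) := by
  have h0 : Real.exp (-gaussNormSq F n 0) = 1 := by
    rw [show gaussNormSq F n 0 = 0 from gaussNormSq_zero, neg_zero, Real.exp_zero]
  rw [← h0]
  exact (summable_exp_neg_gaussNormSq F n).le_tsum 0 fun ζ _ => (Real.exp_pos _).le

/-- **`Re Θ(Φ_G) ≥ 1`.** [cite: Weil1964, Chap. III n° 41, Thm 6 p. 193] -/
theorem one_le_re_thetaDist_gaussSB : 1 ≤ (thetaDist F (Fin n) (gaussSB F n)).re := by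
  rw [thetaDist_gaussSB_eq_ofReal, Complex.ofReal_re]
  exact one_le_tsum_exp_neg_gaussNormSq F n

/-- **`Θ(Φ_G) ≠ 0`.** [cite: Weil1964, Chap. III n° 41, Thm 6 p. 193] -/
theorem thetaDist_gaussSB_ne_zero : thetaDist F (Fin n) (gaussSB F n) ≠ 0 := by
  intro h
  have h1 := one_le_re_thetaDist_gaussSB F n
  rw [h, Complex.zero_re] at h1
  exact absurd h1 (by norm_num)

/-- The same for the linear theta distribution `Θ : 𝒮(𝔸_Fⁿ) →ₗ ℂ`. [cite: Weil1964, Chap. III n° 41, Thm 6 p. 193] -/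
theorem thetaDistLM_gaussSB_ne_zero : thetaDistLM F (Fin n) (gaussSB F n) ≠ 0 :=
  thetaDist_gaussSB_ne_zero F n

end Gaussian

/-! ## §3. Generic by-products: kernel values at the identity and non-zero theta lifts -/

namespace ThetaKernelDatum

universe u v

variable {Mp : Type u} {SX : Type v} [TopologicalSpace Mp] [Group Mp] [TopologicalSpace SX]
variable {GU : Type*} [Group GU] [TopologicalSpace GU] {ΓU : Subgroup GU}
variable {G : Type*} [Group G] [TopologicalSpace G] {Γ : Subgroup G}
variable (M : ThetaKernelDatum Mp SX GU ΓU G Γ)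

/-- **At the identity the kernel upstairs is Weil's `Θ_Φ(1)`**: `thetaFun Φ 1 = Θ_Φ(s(1)⁻¹) = Θ_Φ(1)`.
[cite: Weil1964, Chap. III n° 41 Thm 6 p. 193] -/
theorem thetaFun_one (Φ : SX) : M.thetaFun Φ 1 = M.W.theta Φ 1 := by
  rw [thetaFun_apply, inv_one, map_one]

variable [IsTopologicalGroup GU] [IsTopologicalGroup G]

/-- The slice `q ↦ θ_Φ(ξ, q)` of the theta kernel `θ(h, h')`, a continuous function on `G ⧸ Γ`.
[cite: FleigEtAl2018, §12.3 (12.37)–(12.38)] -/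
def thetaKerSlice (Φ : SX) (ξ : GU ⧸ ΓU) : C(G ⧸ Γ, ℂ) :=
  (M.thetaKer Φ).comp (ContinuousMap.prodMk (ContinuousMap.const (G ⧸ Γ) ξ) (ContinuousMap.id (G ⧸ Γ)))

/-- Unfolding of `thetaKerSlice`. [cite: FleigEtAl2018, §12.3 (12.37)–(12.38)] -/
@[simp] theorem thetaKerSlice_apply (Φ : SX) (ξ : GU ⧸ ΓU) (q : G ⧸ Γ) :
    M.thetaKerSlice Φ ξ q = M.thetaKer Φ (ξ, q) := rfl

variable [CompactSpace (GU ⧸ ΓU)] [CompactSpace (G ⧸ Γ)] [MeasurableSpace (G ⧸ Γ)] [BorelSpace (G ⧸ Γ)]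
  (μ : Measure (G ⧸ Γ)) [IsFiniteMeasure μ]

/-- **The theta lift of `conj θ_Φ(ξ, ·)` at `ξ` is `∫ |θ_Φ(ξ, q)|² dμ(q)`** (`thetaLift_apply`, `z · conj z = |z|²`).
[cite: FleigEtAl2018, §12.3 Definition 12.5 (12.37)] -/
theorem thetaLift_star_slice_apply (Φ : SX) (ξ : GU ⧸ ΓU) :
    M.thetaLift μ Φ (star (M.thetaKerSlice Φ ξ)) ξ = ((∫ q, ‖M.thetaKer Φ (ξ, q)‖ ^ 2 ∂μ : ℝ) : ℂ) := by
  rw [M.thetaLift_apply μ, ← integral_complex_ofReal]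
  refine integral_congr_ae (Filter.Eventually.of_forall fun q => ?_)
  simp only [ContinuousMap.star_apply, thetaKerSlice_apply, Complex.star_def, Complex.mul_conj,
    Complex.normSq_eq_norm_sq, Complex.ofReal_pow]

/-- **A non-zero kernel value gives a non-zero theta lift**: if `θ_Φ(ξ, q₀) ≠ 0` and the finite measure `μ` charges
open sets, then `Θ_Φ(conj θ_Φ(ξ, ·))(ξ) = ∫ |θ_Φ(ξ, ·)|² dμ > 0` (the integrand is continuous, `≥ 0`, and positive at
`q₀`). [cite: FleigEtAl2018, §12.3 Definition 12.5 (12.37)] -/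
theorem thetaLift_star_slice_ne_zero [μ.IsOpenPosMeasure] {Φ : SX} {ξ : GU ⧸ ΓU} {q₀ : G ⧸ Γ}
    (h : M.thetaKer Φ (ξ, q₀) ≠ 0) :
    M.thetaLift μ Φ (star (M.thetaKerSlice Φ ξ)) ξ ≠ 0 := by
  rw [M.thetaLift_star_slice_apply μ, Complex.ofReal_ne_zero]
  refine ne_of_gt ?_
  have hc : Continuous fun q : G ⧸ Γ => ‖M.thetaKer Φ (ξ, q)‖ ^ 2 :=
    ((M.thetaKerSlice Φ ξ).continuous.norm).pow 2
  exact hc.integral_pos_of_hasCompactSupport_nonneg_nonzero (HasCompactSupport.of_compactSpace _)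
    (fun q => sq_nonneg _) (x := q₀) (pow_ne_zero 2 (norm_ne_zero_iff.2 h))

end ThetaKernelDatum

end Literature.NumberTheory.Weil1964

end
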